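import Literature.NumberTheory.EllipticCurves.IwasawaTwistModPk
import Literature.NumberTheory.GaloisRepresentations.ContinuousCohomologyConnecting
import Mathlib.Algebra.CharP.Lemmas
import Mathlib.Algebra.Polynomial.AlgebraMap
import HarnessLib

/-!
# The `ω²`-carrier `M ⊗ (ℤ/p^k)[T]/(ω_m²)(χ_κ)`, `ω_m = (1+T)^{p^m} − 1`, of a `p^k`-torsion discrete Galois
# module along a `ℤ_p`-extension — the coefficient module of the graded core at level `(p^k, ω²)`
# (definitions with bodies + proofs; no named fact)

Topic `NumberTheory/EllipticCurves` (sequel of `IwasawaTwistModPk`); namespaces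
`Literature.NumberTheory.EllipticCurves` (the companion operator and the `ω²`-operators, pure algebra) and
`….ZpExtension` (the Galois module).  Cell `bsd-f3-mu` (crux `KatoDivisibilityX9` = item
stmt-BirchSwinnertonDyer-20547, line `graded_euler_loss`, stub `stub_depthX9`), typing ask **T-es-6 (b)**
(definition item `defn-ZpExtension.twistModOmegaSq`): the ring of the graded core is `A = Λ/(p^{n+1}, ω²)`
(MEMO-es §15), `Λ = ℤ_p⟦T⟧`, `ω = ω_m = (1+T)^{p^m} − 1` the distinguished (monic) polynomial cutting out
`Γ^{p^m}`; its coefficient module is `M ⊗ (ℤ/p^k)[T]/(ω_m²)` with `Γ_K` acting through `ρ ⊗ χ_κ`.  Realised on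
the `T`-basis `1, T, …, T^{2p^m−1}` as `Fin (2·p^m) → M`, `T` acting by the COMPANION OPERATOR `S_ω` of the
monic integer polynomial `ω_m²` (degree `2p^m`) — `S_ω = S − tail`, the tail reading the coefficients of
`ω_m² − T^{2p^m}`, all divisible by `p` (`ω_m ≡ T^{p^m} (mod p)`), so `S_ω = S` on vectors with `p`-torsion
coordinates — and `g ∈ Γ_K` by `U_{κ(g)} ∘ ρ(g)`, `U_a = (1 + S_ω)^a` (`κ(g)` read modulo `p^{2p^m+k}`).

* §1 (any additive group `M`, any `g ∈ ℤ[X]`, any `d`) `companionEnd M g d` — the companion operator of `g`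
  on `Fin d → M` (`(C x)_i = x_{i−1} − g_i·x_{d−1}`), its values on the basis vectors `m·T^j`
  (`companionEnd_single_of_lt`, `companionEnd_single_last`, `companionEnd_pow_single_zero`), commutation
  with coordinatewise maps / operators (`map_companionEnd_apply`, `map_one_add_companionEnd_pow_apply`,
  `companionEnd_mul_compLeft`), and **Cayley–Hamilton for companion operators**: `aeval (companionEnd M g d) g
  = 0` for `g` monic of degree `d` (`aeval_companionEnd_self`: `g(C)(m·T⁰) = Σ_{i<d} g_i m T^i + C^d(m T⁰) = 0`
  and `m·T^j = C^j(m·T⁰)`).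
* §2 `omegaPoly e = (X+1)^e − 1`, `omegaSqPoly e = omegaPoly e ^ 2` (monic, degrees `e`, `2e`),
  `map_omegaPoly_prime_pow : ω_{p^m} ↦ X^{p^m}` in `𝔽_p[X]` and `prime_dvd_coeff_omegaSqPoly`: `p ∣ (ω_{p^m}²)_j`
  for `j < 2p^m`.
* §3 `omegaSqShiftEnd p m M` (`= S_ω`), `omegaEnd p m M` (`= Ω = ω_{p^m}(S_ω)`, multiplication by `ω`),
  `omegaUnipotentPow p m M a` (`= U_a = (1+S_ω)^a`, multiplication by `γ^a`): `omegaEnd_eq : Ω = U_{p^m} − 1`,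
  **`omegaEnd_mul_self : Ω·Ω = 0`** (Cayley–Hamilton), `one_add_omegaEnd_pow : (1+Ω)^c = 1 + c·Ω`,
  `one_add_omegaEnd_pow_eq_one : (1+Ω)^{p^k} = 1` and **`omegaUnipotentPow_prime_pow_add : U_{p^{m+k}} = 1`**
  on `p^k`-torsion `M`, periodicity `omegaUnipotentPow_mod` / `…_eq_one_of_dvd` (levels `N ≥ m + k`), the
  commutations of `S_ω, Ω, U_a` with each other, with coordinatewise operators and with coordinatewise
  additive maps, and **`S_ω ≡ S (mod p)`**: `omegaSqShiftEnd_apply_of_torsion`, `omegaUnipotentPow_apply_of_torsion`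
  (`U_a y = unipotentPow M (2p^m) a y` for `y` with `p`-torsion coordinates).
* §4 **`κ.twistModOmegaSq ρ hM m : DiscreteGaloisModule K (Fin (2 * p^m) → M)`** (`hM : ∀ x, p^k • x = 0`),
  `twistModOmegaSq_apply`, `…_apply_of_level` (any `N ≥ m + k`), `…_apply_of_mem_layerSubgroup` (`Γ_K`-layer
  `N ≥ m + k` acts through `ρ`), **`…_apply_of_mem_layerSubgroup_self`** (`g ∈ Gal(K̄/K_m)` acts by
  `(1 + c·Ω) ∘ ρ(g)`, `κ(g) = p^m c`), `…_apply_of_isTopGenerator` (`γ ↦ (1+S_ω) ∘ ρ(γ)`), equivariance of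
  `S_ω` and `Ω` (`omegaSqShiftEnd_twistModOmegaSq_apply`, `omegaEnd_twistModOmegaSq_apply`), the equivariant
  endomorphisms **`twistModOmegaSqShift`** (`T·`) and **`twistModOmegaSqOmega`** (`ω·`, with
  `twistModOmegaSqOmega_apply_apply : ω·ω· = 0`, i.e. `ω·carrier ⊆ ker ω·`, and `…_apply_eq : ω· = γ^{p^m} − 1`),
  functoriality **`twistModOmegaSqMap`** in `M`.
* §5 REDUCTION MOD `p` (item (i)): for `p`-torsion coefficients the `ω²`-carrier IS the model
  `κ.twistModP ρ hM1 (2·p^m)` (**`twistModOmegaSq_eq_twistModP`**, equality of discrete Galois modules), the map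
  **`ι = twistModPToOmegaSq f : 𝒯_{2p^m}(M') → (ω²-carrier of M)`** along an equivariant `f : M' → M` (`M'`
  `p`-torsion, e.g. `E[p] ⊂ E[p^k]`), `ι_* = galoisCohomology.map ι 1`; a short exact sequence of coefficient
  modules `0 → M' → M → M'' → 0` gives a short exact sequence of carriers (**`isSES_twistModPToOmegaSq`**, tree
  `IsSES`), left exactness of `H⁰` along it (`twistModOmegaSq_invariant_eq_zero_of_isSES`, the dévissage step
  reducing `H⁰ = 0` for the carriers of `E[p^j]` to the mod-`p` model), and **`ι_*` is injective as soon as the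
  invariants of the `ω²`-carrier of `M''` vanish** (`map_twistModPToOmegaSq_injective_of_isSES`, via
  `IsSES.exists_δ₀_eq_of_map_one_eq_zero`).
* §6 the elliptic specialisation `W.modOmegaSqTwist p k κ m` on `Fin (2·p^m) → E[p^k]`
  (`E[p^k] = W.torsionGaloisModule ((p : ℤ) ^ k)`), with `_apply`, `_apply_of_isTopGenerator`,
  `_apply_of_mem_layerSubgroup`.

NOT HERE (honest): the ring-level facts `ann(ω) = (ω)` in `R[X]/(ω²)` and the Frobenius (Gorenstein)
self-duality of `R[X]/(ω²)` via `λ = lcoeff_{2p^m−1}` are PROVED in the tree on the Summits side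
(`…GradedRing.annihilator_of_monic_sq`, `…GradedRing.bijective_frobeniusForm_of_finite`, p615549, on
`AdjoinRoot (ω^2)` over `ZMod (p^(n+1))`) and are not restated in Literature (items (ii)/(iii) of the ask say:
cite, do not restate); at the carrier level this file provides `ω·` with `ω·ω· = 0` and its equivariance, not
the identification `ker(ω·) = ω·carrier` nor an explicit isomorphism with `M ⊗ AdjoinRoot (ω_m²)` or a
`μ`-valued self-pairing of the carrier (left to the consumer; the `T^J`-analogue is `IwasawaTwistModPkDual`).

References: L. Washington, *Introduction to Cyclotomic Fields* §7.1–7.2 (distinguished polynomials,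
`Λ/(p^k, f)`), §13.1–13.2 (`Γ`-action through `(1+T)^a`) [Washington1997]; B. Mazur, K. Rubin, Mem. AMS 799
(2004) §5.3 (coefficients `T ⊗ Λ/𝔪^kΛ`-type, functoriality) [MazurRubin2004]; J.-P. Serre, *Galois Cohomology*
I §2.2 (long exact sequence, `δ₀`) [SerreGaloisCohomology1997]; K. Rubin, *Euler Systems* (2000) §II.4;
cell bsd-f3-mu MEMO-es §15 STEPS 2–4, §25.3.
-/

noncomputable section

open scoped Topology ContRepresentation
open Field Filter Polynomial

universe u

namespace Literature.NumberTheory.EllipticCurves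

open Literature.NumberTheory.GaloisRepresentations

/-! ## §1 The companion operator of an integer polynomial on `Fin d → M` and Cayley–Hamilton -/

section Companion

variable (M : Type*) [AddCommGroup M] (g : ℤ[X]) (d : ℕ)

/-- The **tail operator** of `g` on `Fin d → M`: `(tail x)_i = g_i · x_{d−1}` (the correction of the shift in
the companion matrix of a monic `g` of degree `d`: `T·T^{d−1} = T^d = −Σ_{i<d} g_i T^i`).
[cite: Washington1997, §7.1–§7.2] -/
def tailEnd : Module.End ℤ (Fin d → M) where
  toFun x i := g.coeff i • x ⟨d - 1, by have := i.2; omega⟩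
  map_add' x y := funext fun i => by simp only [Pi.add_apply, smul_add]
  map_smul' c x := funext fun i => by simp only [Pi.smul_apply, RingHom.id_apply, smul_comm (g.coeff _) c]

variable {M} in
/-- Unfolding `tailEnd`. [cite: Washington1997, §7.1–§7.2] -/
theorem tailEnd_apply (x : Fin d → M) (i : Fin d) :
    tailEnd M g d x i = g.coeff i • x ⟨d - 1, by have := i.2; omega⟩ := rfl

/-- **The companion operator** of `g ∈ ℤ[X]` on `Fin d → M` (coordinates = coefficients of `1, T, …, T^{d−1}`):
`(C x)_i = x_{i−1} − g_i · x_{d−1}` (`x_{−1} := 0`), i.e. multiplication by `T` on `M ⊗ ℤ[T]/(g)` in the power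
basis when `g` is monic of degree `d` (`T^d ≡ −Σ_{i<d} g_i T^i`).  [cite: Washington1997, §7.1–§7.2] -/
def companionEnd : Module.End ℤ (Fin d → M) := shiftEnd M d - tailEnd M g d

variable {M g d}

/-- Unfolding the definition `companionEnd = S − tail`. [cite: Washington1997, §7.1–§7.2] -/
theorem companionEnd_def : companionEnd M g d = shiftEnd M d - tailEnd M g d := rfl

/-- Unfolding `companionEnd`. [cite: Washington1997, §7.1–§7.2] -/
theorem companionEnd_apply (x : Fin d → M) (i : Fin d) :
    companionEnd M g d x i = shiftEnd M d x i - g.coeff i • x ⟨d - 1, by have := i.2; omega⟩ := rfl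

/-- The shift on a basis vector below the top: `S (m·T^j) = m·T^{j+1}` (`j + 1 < d`).
[cite: Washington1997, §13.1–§13.2] -/
theorem shiftEnd_single_of_lt {j : ℕ} (hj : j + 1 < d) (m : M) :
    shiftEnd M d (Pi.single (⟨j, by omega⟩ : Fin d) m) = Pi.single (⟨j + 1, hj⟩ : Fin d) m := by
  funext i
  rw [shiftEnd_apply]
  by_cases h : (i : ℕ) = 0
  · rw [dif_pos h, Pi.single_apply, if_neg]
    intro hi
    rw [Fin.ext_iff] at hi
    simp only at hi
    omega
  · rw [dif_neg h, Pi.single_apply, Pi.single_apply]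
    by_cases hij : (i : ℕ) = j + 1
    · rw [if_pos (Fin.ext (by simp only; omega)), if_pos (Fin.ext hij)]
    · rw [if_neg, if_neg (fun hi => hij (by rw [Fin.ext_iff] at hi; exact hi))]
      intro hi
      rw [Fin.ext_iff] at hi
      simp only at hi
      omega

/-- The shift kills the top basis vector: `S (m·T^{d−1}) = 0` on `Fin d → M` (truncation).
[cite: Washington1997, §13.1–§13.2] -/
theorem shiftEnd_single_top (hd : 0 < d) (m : M) :
    shiftEnd M d (Pi.single (⟨d - 1, Nat.sub_lt hd Nat.one_pos⟩ : Fin d) m) = 0 := by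
  funext i
  rw [shiftEnd_apply, Pi.zero_apply]
  by_cases h : (i : ℕ) = 0
  · rw [dif_pos h]
  · rw [dif_neg h, Pi.single_apply, if_neg]
    intro hi
    rw [Fin.ext_iff] at hi
    simp only at hi
    have := i.2
    omega

/-- The tail operator vanishes on basis vectors below the top. [cite: Washington1997, §7.1–§7.2] -/
theorem tailEnd_single_of_lt {j : ℕ} (hj : j + 1 < d) (m : M) :
    tailEnd M g d (Pi.single (⟨j, by omega⟩ : Fin d) m) = 0 := by
  funext i
  rw [tailEnd_apply, Pi.zero_apply, Pi.single_apply, if_neg, smul_zero]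
  intro h
  rw [Fin.ext_iff] at h
  simp only at h
  omega

/-- The tail operator on the top basis vector: `tail (m·T^{d−1}) = (g_i · m)_i`. [cite: Washington1997, §7.1–§7.2] -/
theorem tailEnd_single_last (hd : 0 < d) (m : M) :
    tailEnd M g d (Pi.single (⟨d - 1, Nat.sub_lt hd Nat.one_pos⟩ : Fin d) m) =
      fun i : Fin d => g.coeff i • m := by
  funext i
  rw [tailEnd_apply, Pi.single_apply, if_pos (Fin.ext rfl)]

/-- **The companion operator on a basis vector below the top**: `C (m·T^j) = m·T^{j+1}` (`j + 1 < d`).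
[cite: Washington1997, §7.1–§7.2] -/
theorem companionEnd_single_of_lt {j : ℕ} (hj : j + 1 < d) (m : M) :
    companionEnd M g d (Pi.single (⟨j, by omega⟩ : Fin d) m) = Pi.single (⟨j + 1, hj⟩ : Fin d) m := by
  rw [companionEnd_def, LinearMap.sub_apply, shiftEnd_single_of_lt hj, tailEnd_single_of_lt hj, sub_zero]

/-- **The companion operator on the top basis vector**: `C (m·T^{d−1}) = −Σ_{i<d} g_i m·T^i` (the relation
`T^d = −Σ_{i<d} g_i T^i`). [cite: Washington1997, §7.1–§7.2] -/
theorem companionEnd_single_last (hd : 0 < d) (m : M) :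
    companionEnd M g d (Pi.single (⟨d - 1, Nat.sub_lt hd Nat.one_pos⟩ : Fin d) m) =
      -fun i : Fin d => g.coeff i • m := by
  rw [companionEnd_def, LinearMap.sub_apply, shiftEnd_single_top hd, tailEnd_single_last hd, zero_sub]

/-- `C^j (m·T⁰) = m·T^j` for `j < d`. [cite: Washington1997, §7.1–§7.2] -/
theorem companionEnd_pow_single_zero {j : ℕ} (hj : j < d) (m : M) :
    (companionEnd M g d ^ j) (Pi.single (⟨0, by omega⟩ : Fin d) m) = Pi.single (⟨j, hj⟩ : Fin d) m := by
  induction j with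
  | zero => rfl
  | succ j ih =>
    rw [pow_succ', Module.End.mul_apply, ih (by omega), companionEnd_single_of_lt]

/-- `C^j (m·T⁰) = m·T^j` for `j : Fin d`. [cite: Washington1997, §7.1–§7.2] -/
theorem companionEnd_pow_single_zero' (j : Fin d) (m : M) :
    (companionEnd M g d ^ (j : ℕ)) (Pi.single (⟨0, by have := j.2; omega⟩ : Fin d) m) = Pi.single j m :=
  companionEnd_pow_single_zero j.2 m

section Map

variable {M' : Type*} [AddCommGroup M'] {Φ : Type*} [FunLike Φ M M'] [AddMonoidHomClass Φ M M']

/-- A coordinatewise additive map commutes with the companion operators: `f ∘ (C x) = C (f ∘ x)`.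
[cite: Washington1997, §7.1–§7.2] -/
theorem map_companionEnd_apply (f : Φ) (x : Fin d → M) :
    (fun i => f (companionEnd M g d x i)) = companionEnd M' g d (fun i => f (x i)) := by
  funext i
  rw [companionEnd_apply, companionEnd_apply, map_sub, map_zsmul, ← map_shiftEnd_apply f x]

/-- A coordinatewise additive map commutes with the powers of `1 + C`. [cite: Washington1997, §7.1–§7.2] -/
theorem map_one_add_companionEnd_pow_apply (f : Φ) (a : ℕ) (x : Fin d → M) :
    (fun i => f (((1 + companionEnd M g d) ^ a) x i)) =
      ((1 + companionEnd M' g d) ^ a) (fun i => f (x i)) := by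
  induction a generalizing x with
  | zero => simp
  | succ a ih =>
    rw [pow_succ, pow_succ, Module.End.mul_apply, Module.End.mul_apply, ih, LinearMap.add_apply,
      Module.End.one_apply, LinearMap.add_apply, Module.End.one_apply, ← map_companionEnd_apply f]
    congr 1
    funext i
    exact map_add f _ _

end Map

/-- The companion operator commutes with every coordinatewise linear operator (`compLeft`).
[cite: Washington1997, §7.1–§7.2] -/
theorem companionEnd_mul_compLeft (f : M →ₗ[ℤ] M) :
    companionEnd M g d * f.compLeft (Fin d) = f.compLeft (Fin d) * companionEnd M g d := by
  refine LinearMap.ext fun x => ?_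
  change companionEnd M g d (fun i => f (x i)) = fun i => f (companionEnd M g d x i)
  exact (map_companionEnd_apply f x).symm

/-- Hence every power of `1 + C` commutes with every coordinatewise operator. [cite: Washington1997, §7.1–§7.2] -/
theorem one_add_companionEnd_pow_mul_compLeft (a : ℕ) (f : M →ₗ[ℤ] M) :
    (1 + companionEnd M g d) ^ a * f.compLeft (Fin d) = f.compLeft (Fin d) * (1 + companionEnd M g d) ^ a :=
  (((Commute.one_left _).add_left (companionEnd_mul_compLeft f)).pow_left a).eq

/-- `aeval C` commutes with `C^j`. [folklore] -/
private theorem aeval_companionEnd_mul_pow (h : ℤ[X]) (j : ℕ) :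
    aeval (companionEnd M g d) h * companionEnd M g d ^ j =
      companionEnd M g d ^ j * aeval (companionEnd M g d) h := by
  rw [← aeval_X_pow (R := ℤ) (companionEnd M g d), ← map_mul, ← map_mul, mul_comm]

/-- **Cayley–Hamilton for companion operators**: `g(C) = 0` on `Fin d → M` for `g` monic of degree `d`.
Proof: on `m·T⁰`, `g(C)(m T⁰) = Σ_{i<d} g_i C^i(m T⁰) + C^d(m T⁰) = Σ_{i<d} g_i m T^i + C(m T^{d−1}) = 0`; the
basis vectors `m·T^j = C^j(m·T⁰)` are then killed because `g(C)` commutes with `C`, and they span.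
[cite: Washington1997, §7.1–§7.2] -/
theorem aeval_companionEnd_self (hg : g.Monic) (hgd : g.natDegree = d) :
    aeval (companionEnd M g d) g = 0 := by
  classical
  rcases Nat.eq_zero_or_pos d with rfl | hd
  · exact LinearMap.ext fun x => funext fun i => Fin.elim0 i
  have hc : g.coeff d = 1 := hgd ▸ hg.coeff_natDegree
  -- the value on `m · T⁰`
  have h0 : ∀ m : M, aeval (companionEnd M g d) g (Pi.single (⟨0, hd⟩ : Fin d) m) = 0 := by
    intro m
    rw [aeval_eq_sum_range, hgd, LinearMap.sum_apply, Finset.sum_range_succ, hc, one_smul]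
    -- `C^d (m T⁰) = C (m T^{d-1}) = -Σ g_i m T^i`
    have htop : (companionEnd M g d ^ d) (Pi.single (⟨0, hd⟩ : Fin d) m) =
        -fun i : Fin d => g.coeff i • m := by
      have hpow : companionEnd M g d ^ d = companionEnd M g d * companionEnd M g d ^ (d - 1) := by
        rw [← pow_succ', Nat.sub_add_cancel hd]
      rw [hpow, Module.End.mul_apply, companionEnd_pow_single_zero (Nat.sub_lt hd Nat.one_pos),
        companionEnd_single_last hd]
    have hlow : ∑ i ∈ Finset.range d,
        (g.coeff i • companionEnd M g d ^ i) (Pi.single (⟨0, hd⟩ : Fin d) m) =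
          fun i : Fin d => g.coeff i • m := by
      rw [← Finset.univ_sum_single (fun i : Fin d => g.coeff (i : ℕ) • m),
        ← Fin.sum_univ_eq_sum_range (fun i => (g.coeff i • companionEnd M g d ^ i)
          (Pi.single (⟨0, hd⟩ : Fin d) m)) d]
      refine Finset.sum_congr rfl fun j _ => ?_
      rw [LinearMap.smul_apply, companionEnd_pow_single_zero' j m, Pi.single_smul]
    rw [htop, hlow, add_neg_cancel]
  -- the value on `m · T^j = C^j (m · T⁰)`
  have hj : ∀ (j : Fin d) (m : M), aeval (companionEnd M g d) g (Pi.single j m) = 0 := by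
    intro j m
    rw [← companionEnd_pow_single_zero' j m, ← Module.End.mul_apply, aeval_companionEnd_mul_pow,
      Module.End.mul_apply, h0, map_zero]
  refine LinearMap.ext fun x => ?_
  rw [← Finset.univ_sum_single x, map_sum, LinearMap.zero_apply]
  exact Finset.sum_eq_zero fun j _ => hj j (x j)

end Companion

/-! ## §2 The distinguished polynomials `ω_e = (X+1)^e − 1` and `ω_e²` -/

section Omega

/-- `ω_e := (X + 1)^e − 1 ∈ ℤ[X]` — for `e = p^m` the distinguished polynomial `(1+T)^{p^m} − 1 = γ^{p^m} − 1`
cutting out `Γ^{p^m}` (`Λ/(ω_{p^m}) = ℤ_p[Γ/Γ^{p^m}]`). [cite: Washington1997, §7.1–§7.2] -/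
def omegaPoly (e : ℕ) : ℤ[X] := (X + 1) ^ e - 1

/-- `ω_e²`. [cite: Washington1997, §7.1–§7.2] -/
def omegaSqPoly (e : ℕ) : ℤ[X] := omegaPoly e ^ 2

/-- `(X + 1)^e` is monic. [folklore] -/
private theorem monic_X_add_one_pow (e : ℕ) : ((X + 1 : ℤ[X]) ^ e).Monic := by
  have h : (X + 1 : ℤ[X]) = X + C 1 := by rw [C_1]
  rw [h]
  exact (monic_X_add_C 1).pow e

/-- `deg (X + 1)^e = e`. [folklore] -/
private theorem natDegree_X_add_one_pow (e : ℕ) : ((X + 1 : ℤ[X]) ^ e).natDegree = e := by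
  have h : (X + 1 : ℤ[X]) = X + C 1 := by rw [C_1]
  rw [h, (monic_X_add_C (1 : ℤ)).natDegree_pow, natDegree_X_add_C, mul_one]

/-- `ω_e` is monic for `e ≥ 1`. [cite: Washington1997, §7.1–§7.2] -/
theorem monic_omegaPoly {e : ℕ} (he : 0 < e) : (omegaPoly e).Monic := by
  refine (monic_X_add_one_pow e).sub_of_left ?_
  rw [degree_one, degree_eq_natDegree (monic_X_add_one_pow e).ne_zero, natDegree_X_add_one_pow]
  exact_mod_cast he

/-- `deg ω_e = e` (`e ≥ 1`). [cite: Washington1997, §7.1–§7.2] -/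
theorem natDegree_omegaPoly {e : ℕ} (he : 0 < e) : (omegaPoly e).natDegree = e := by
  rw [omegaPoly, natDegree_sub_eq_left_of_natDegree_lt, natDegree_X_add_one_pow]
  rw [natDegree_one, natDegree_X_add_one_pow]
  exact he

/-- `ω_e²` is monic (`e ≥ 1`). [cite: Washington1997, §7.1–§7.2] -/
theorem monic_omegaSqPoly {e : ℕ} (he : 0 < e) : (omegaSqPoly e).Monic := (monic_omegaPoly he).pow 2

/-- `deg ω_e² = 2e` (`e ≥ 1`). [cite: Washington1997, §7.1–§7.2] -/
theorem natDegree_omegaSqPoly {e : ℕ} (he : 0 < e) : (omegaSqPoly e).natDegree = 2 * e := by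
  rw [omegaSqPoly, (monic_omegaPoly he).natDegree_pow, natDegree_omegaPoly he, mul_comm]

/-- In `𝔽_p[X]`, `ω_{p^m} = X^{p^m}` (freshman's dream `(X+1)^{p^m} = X^{p^m} + 1`).
[cite: Washington1997, §7.1–§7.2] -/
theorem map_omegaPoly_prime_pow (p : ℕ) [Fact p.Prime] (m : ℕ) :
    (omegaPoly (p ^ m)).map (Int.castRingHom (ZMod p)) = X ^ p ^ m := by
  rw [omegaPoly, Polynomial.map_sub, Polynomial.map_pow, Polynomial.map_add, Polynomial.map_X,
    Polynomial.map_one, add_pow_char_pow, one_pow, add_sub_cancel_right]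

/-- **`ω_{p^m}² ≡ T^{2p^m} (mod p)`**: every coefficient of `ω_{p^m}²` below degree `2p^m` is divisible by
`p` — the companion operator of `ω_{p^m}²` is the plain shift on `p`-torsion vectors.
[cite: Washington1997, §7.1–§7.2] -/
theorem prime_dvd_coeff_omegaSqPoly (p : ℕ) [Fact p.Prime] (m : ℕ) {j : ℕ} (hj : j < 2 * p ^ m) :
    (p : ℤ) ∣ (omegaSqPoly (p ^ m)).coeff j := by
  have h : ((omegaSqPoly (p ^ m)).map (Int.castRingHom (ZMod p))).coeff j = 0 := by
    rw [omegaSqPoly, Polynomial.map_pow, map_omegaPoly_prime_pow, ← pow_mul, Polynomial.coeff_X_pow, if_neg]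
    omega
  rw [Polynomial.coeff_map, eq_intCast] at h
  rw [← ZMod.intCast_zmod_eq_zero_iff_dvd]
  exact h

end Omega

/-! ## §3 The operators `S_ω` (multiplication by `T`), `Ω` (multiplication by `ω_{p^m}`) and
`U_a = (1+S_ω)^a` (multiplication by `γ^a`) on `Fin (2·p^m) → M` -/

section OmegaOps

variable (p : ℕ) [Fact p.Prime] (m : ℕ) (M : Type*) [AddCommGroup M] {k : ℕ}

/-- `0 < p^m`; private helper. [folklore] -/
private theorem prime_pow_pos' : 0 < p ^ m := pow_pos (Fact.out : p.Prime).pos m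

/-- **`S_ω`** — multiplication by `T` on `M ⊗ ℤ[T]/(ω_{p^m}²)` in the power basis `1, T, …, T^{2p^m−1}`:
the companion operator of the monic polynomial `ω_{p^m}² ∈ ℤ[T]` (degree `2p^m`) on `Fin (2·p^m) → M`
(`S_ω = S − tail`, the tail reading the lower coefficients of `ω_{p^m}²`, all divisible by `p`).
[cite: Washington1997, §7.1–§7.2] -/
def omegaSqShiftEnd : Module.End ℤ (Fin (2 * p ^ m) → M) :=
  companionEnd M (omegaSqPoly (p ^ m)) (2 * p ^ m)

/-- **`Ω`** — multiplication by `ω_{p^m} = (1+T)^{p^m} − 1` on `M ⊗ ℤ[T]/(ω_{p^m}²)`: `Ω = ω_{p^m}(S_ω)`.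
[cite: Washington1997, §7.1–§7.2] -/
def omegaEnd : Module.End ℤ (Fin (2 * p ^ m) → M) :=
  aeval (omegaSqShiftEnd p m M) (omegaPoly (p ^ m))

/-- **`U_a = (1 + S_ω)^a`** — multiplication by `(1+T)^a = γ^a` on `M ⊗ ℤ[T]/(ω_{p^m}²)` (`T = γ − 1`).
[cite: Washington1997, §13.1–§13.2] -/
def omegaUnipotentPow (a : ℕ) : Module.End ℤ (Fin (2 * p ^ m) → M) := (1 + omegaSqShiftEnd p m M) ^ a

variable {p m M}

omit [Fact p.Prime] in
/-- Unfolding `omegaSqShiftEnd`. [cite: Washington1997, §7.1–§7.2] -/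
theorem omegaSqShiftEnd_def : omegaSqShiftEnd p m M = companionEnd M (omegaSqPoly (p ^ m)) (2 * p ^ m) :=
  rfl

omit [Fact p.Prime] in
/-- Unfolding `omegaUnipotentPow`. [cite: Washington1997, §13.1–§13.2] -/
theorem omegaUnipotentPow_def (a : ℕ) : omegaUnipotentPow p m M a = (1 + omegaSqShiftEnd p m M) ^ a := rfl

omit [Fact p.Prime] in
/-- `U_0 = 1`. [cite: Washington1997, §13.1–§13.2] -/
@[simp] theorem omegaUnipotentPow_zero : omegaUnipotentPow p m M 0 = 1 := pow_zero _

omit [Fact p.Prime] in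
/-- `U_1 = 1 + S_ω`. [cite: Washington1997, §13.1–§13.2] -/
theorem omegaUnipotentPow_one : omegaUnipotentPow p m M 1 = 1 + omegaSqShiftEnd p m M := pow_one _

omit [Fact p.Prime] in
/-- `U_{a+b} = U_a U_b`. [cite: Washington1997, §13.1–§13.2] -/
theorem omegaUnipotentPow_add (a b : ℕ) :
    omegaUnipotentPow p m M (a + b) = omegaUnipotentPow p m M a * omegaUnipotentPow p m M b :=
  pow_add _ _ _

omit [Fact p.Prime] in
/-- `Ω = (1 + S_ω)^{p^m} − 1 = U_{p^m} − 1` (`ω_{p^m} = (1+T)^{p^m} − 1`). [cite: Washington1997, §7.1–§7.2] -/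
theorem omegaEnd_eq : omegaEnd p m M = omegaUnipotentPow p m M (p ^ m) - 1 := by
  rw [omegaEnd, omegaPoly, map_sub, map_pow, map_add, aeval_X, map_one, add_comm, omegaUnipotentPow_def]

omit [Fact p.Prime] in
/-- `U_{p^m} = 1 + Ω`: `γ^{p^m} = 1 + ω_{p^m}`. [cite: Washington1997, §7.1–§7.2] -/
theorem omegaUnipotentPow_prime_pow : omegaUnipotentPow p m M (p ^ m) = 1 + omegaEnd p m M := by
  rw [omegaEnd_eq, add_sub_cancel]

/-- **`Ω ∘ Ω = 0`**: `ω_{p^m}² = 0` in `ℤ[T]/(ω_{p^m}²)` — Cayley–Hamilton for the companion operator of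
`ω_{p^m}²` (`aeval_companionEnd_self`). [cite: Washington1997, §7.1–§7.2] -/
theorem omegaEnd_mul_self : omegaEnd p m M * omegaEnd p m M = 0 := by
  rw [omegaEnd, ← map_mul, ← pow_two]
  show aeval (companionEnd M (omegaSqPoly (p ^ m)) (2 * p ^ m)) (omegaSqPoly (p ^ m)) = 0
  exact aeval_companionEnd_self (monic_omegaSqPoly (prime_pow_pos' p m))
    (natDegree_omegaSqPoly (prime_pow_pos' p m))

/-- `Ω (Ω x) = 0`. [cite: Washington1997, §7.1–§7.2] -/
theorem omegaEnd_omegaEnd_apply (x : Fin (2 * p ^ m) → M) : omegaEnd p m M (omegaEnd p m M x) = 0 := by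
  rw [← Module.End.mul_apply, omegaEnd_mul_self, LinearMap.zero_apply]

omit [Fact p.Prime] in
/-- `S_ω` commutes with every `U_a`. [cite: Washington1997, §13.1–§13.2] -/
theorem commute_omegaSqShiftEnd_omegaUnipotentPow (a : ℕ) :
    Commute (omegaSqShiftEnd p m M) (omegaUnipotentPow p m M a) :=
  ((Commute.one_right _).add_right (Commute.refl _)).pow_right a

omit [Fact p.Prime] in
/-- `S_ω` commutes with `Ω`. [cite: Washington1997, §7.1–§7.2] -/
theorem commute_omegaSqShiftEnd_omegaEnd : Commute (omegaSqShiftEnd p m M) (omegaEnd p m M) := by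
  rw [omegaEnd_eq]
  exact (commute_omegaSqShiftEnd_omegaUnipotentPow (p ^ m)).sub_right (Commute.one_right _)

omit [Fact p.Prime] in
/-- `Ω` commutes with every `U_a`. [cite: Washington1997, §13.1–§13.2] -/
theorem commute_omegaEnd_omegaUnipotentPow (a : ℕ) : Commute (omegaEnd p m M) (omegaUnipotentPow p m M a) :=
  ((Commute.one_right _).add_right commute_omegaSqShiftEnd_omegaEnd.symm).pow_right a

/-- **`(1 + Ω)^c = 1 + c·Ω`** (`Ω² = 0`). [cite: Washington1997, §7.1–§7.2] -/
theorem one_add_omegaEnd_pow (c : ℕ) :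
    (1 + omegaEnd p m M) ^ c = 1 + (c : Module.End ℤ (Fin (2 * p ^ m) → M)) * omegaEnd p m M := by
  induction c with
  | zero => rw [pow_zero, Nat.cast_zero, zero_mul, add_zero]
  | succ c ih =>
    rw [pow_succ, ih, Nat.cast_succ, add_mul, one_mul, mul_add, mul_one, mul_assoc, omegaEnd_mul_self, mul_zero,
      add_zero, add_mul, one_mul]
    abel

/-- **`(1 + Ω)^{p^k} = 1` on a module killed by `p^k`**: `(1+Ω)^{p^k} = 1 + p^k·Ω` and `p^k` acts by `0`.
[cite: Washington1997, §13.1–§13.2] -/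
theorem one_add_omegaEnd_pow_eq_one (hM : ∀ x : M, p ^ k • x = 0) : (1 + omegaEnd p m M) ^ p ^ k = 1 := by
  rw [one_add_omegaEnd_pow, natCast_moduleEnd_eq_zero_of_pow_smul hM dvd_rfl, zero_mul, add_zero]

/-- **`U_{p^{m+k}} = 1` on a module killed by `p^k`**: `(1+T)^{p^{m+k}} = (1 + ω_{p^m})^{p^k} = 1` in
`(ℤ/p^k)[T]/(ω_{p^m}²)` — the twist character of `Γ` on the `ω²`-carrier factors through `Γ/Γ^{p^{m+k}}`.
[cite: Washington1997, §13.1–§13.2] -/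
theorem omegaUnipotentPow_prime_pow_add (hM : ∀ x : M, p ^ k • x = 0) :
    omegaUnipotentPow p m M (p ^ (m + k)) = 1 := by
  rw [omegaUnipotentPow_def, pow_add, pow_mul, ← omegaUnipotentPow_def, omegaUnipotentPow_prime_pow,
    one_add_omegaEnd_pow_eq_one hM]

/-- Hence `U_a = 1` whenever `p^N ∣ a` for some `N ≥ m + k` (`p^k • M = 0`). [cite: Washington1997, §13.1–§13.2] -/
theorem omegaUnipotentPow_eq_one_of_dvd (hM : ∀ x : M, p ^ k • x = 0) {N a : ℕ} (hN : m + k ≤ N)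
    (ha : p ^ N ∣ a) : omegaUnipotentPow p m M a = 1 := by
  obtain ⟨c, rfl⟩ := (pow_dvd_pow p hN).trans ha
  rw [omegaUnipotentPow_def, pow_mul, ← omegaUnipotentPow_def, omegaUnipotentPow_prime_pow_add hM, one_pow]

/-- Hence `U_a` only depends on `a` modulo `p^N` for `N ≥ m + k` (`p^k • M = 0`). [cite: Washington1997, §13.1–§13.2] -/
theorem omegaUnipotentPow_mod (hM : ∀ x : M, p ^ k • x = 0) {N : ℕ} (hN : m + k ≤ N) (a : ℕ) :
    omegaUnipotentPow p m M (a % p ^ N) = omegaUnipotentPow p m M a := by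
  conv_rhs => rw [← Nat.div_add_mod a (p ^ N), omegaUnipotentPow_add,
    omegaUnipotentPow_eq_one_of_dvd hM hN (dvd_mul_right _ _), one_mul]

omit [Fact p.Prime] in
/-- `S_ω` commutes with every coordinatewise operator. [cite: Washington1997, §7.1–§7.2] -/
theorem omegaSqShiftEnd_mul_compLeft (f : M →ₗ[ℤ] M) :
    omegaSqShiftEnd p m M * f.compLeft (Fin (2 * p ^ m)) = f.compLeft (Fin (2 * p ^ m)) * omegaSqShiftEnd p m M :=
  companionEnd_mul_compLeft f

omit [Fact p.Prime] in
/-- `U_a` commutes with every coordinatewise operator. [cite: Washington1997, §13.1–§13.2] -/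
theorem omegaUnipotentPow_mul_compLeft (a : ℕ) (f : M →ₗ[ℤ] M) :
    omegaUnipotentPow p m M a * f.compLeft (Fin (2 * p ^ m)) =
      f.compLeft (Fin (2 * p ^ m)) * omegaUnipotentPow p m M a :=
  one_add_companionEnd_pow_mul_compLeft a f

omit [Fact p.Prime] in
/-- `Ω` commutes with every coordinatewise operator. [cite: Washington1997, §7.1–§7.2] -/
theorem omegaEnd_mul_compLeft (f : M →ₗ[ℤ] M) :
    omegaEnd p m M * f.compLeft (Fin (2 * p ^ m)) = f.compLeft (Fin (2 * p ^ m)) * omegaEnd p m M := by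
  rw [omegaEnd_eq, sub_mul, mul_sub, one_mul, mul_one, omegaUnipotentPow_mul_compLeft]

section Map

variable {M' : Type*} [AddCommGroup M'] {Φ : Type*} [FunLike Φ M M'] [AddMonoidHomClass Φ M M']

omit [Fact p.Prime] in
/-- A coordinatewise additive map commutes with `S_ω`. [cite: Washington1997, §7.1–§7.2] -/
theorem map_omegaSqShiftEnd_apply (f : Φ) (x : Fin (2 * p ^ m) → M) :
    (fun i => f (omegaSqShiftEnd p m M x i)) = omegaSqShiftEnd p m M' (fun i => f (x i)) :=
  map_companionEnd_apply f x

omit [Fact p.Prime] in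
/-- A coordinatewise additive map commutes with every `U_a`. [cite: Washington1997, §13.1–§13.2] -/
theorem map_omegaUnipotentPow_apply (f : Φ) (a : ℕ) (x : Fin (2 * p ^ m) → M) :
    (fun i => f (omegaUnipotentPow p m M a x i)) = omegaUnipotentPow p m M' a (fun i => f (x i)) :=
  map_one_add_companionEnd_pow_apply f a x

omit [Fact p.Prime] in
/-- A coordinatewise additive map commutes with `Ω`. [cite: Washington1997, §7.1–§7.2] -/
theorem map_omegaEnd_apply (f : Φ) (x : Fin (2 * p ^ m) → M) :
    (fun i => f (omegaEnd p m M x i)) = omegaEnd p m M' (fun i => f (x i)) := by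
  funext i
  rw [omegaEnd_eq, omegaEnd_eq, LinearMap.sub_apply, LinearMap.sub_apply, Pi.sub_apply, Pi.sub_apply,
    map_sub, Module.End.one_apply, Module.End.one_apply, ← map_omegaUnipotentPow_apply f (p ^ m) x]

end Map

/-! ### `S_ω ≡ S (mod p)`: on vectors with `p`-torsion coordinates the `ω²`-operators are the `T^{2p^m}`-ones -/

/-- **On a vector with `p`-torsion coordinates, `S_ω y = S y`**: the tail coefficients of `ω_{p^m}²` are
divisible by `p` (`prime_dvd_coeff_omegaSqPoly`). [cite: Washington1997, §7.1–§7.2] -/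
theorem omegaSqShiftEnd_apply_of_torsion (y : Fin (2 * p ^ m) → M) (hy : ∀ i, p • y i = 0) :
    omegaSqShiftEnd p m M y = shiftEnd M (2 * p ^ m) y := by
  funext i
  rw [omegaSqShiftEnd_def, companionEnd_apply, sub_eq_self]
  obtain ⟨c, hc⟩ := prime_dvd_coeff_omegaSqPoly p m i.2
  rw [hc, mul_comm, mul_smul, natCast_zsmul, hy, smul_zero]

omit [Fact p.Prime] in
/-- The shift preserves the vectors with `p`-torsion coordinates; private helper. [folklore] -/
private theorem torsion_one_add_shiftEnd_apply (y : Fin (2 * p ^ m) → M) (hy : ∀ i, p • y i = 0)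
    (i : Fin (2 * p ^ m)) : p • (1 + shiftEnd M (2 * p ^ m)) y i = 0 := by
  rw [LinearMap.add_apply, Module.End.one_apply, Pi.add_apply, smul_add, hy, zero_add, shiftEnd_apply]
  split_ifs
  · exact smul_zero _
  · exact hy _

/-- **On a vector with `p`-torsion coordinates, `U_a y = (1+S)^a y`** (`unipotentPow` of the `T^{2p^m}`-model
`IwasawaTwistModP`). [cite: Washington1997, §13.1–§13.2] -/
theorem omegaUnipotentPow_apply_of_torsion (a : ℕ) (y : Fin (2 * p ^ m) → M) (hy : ∀ i, p • y i = 0) :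
    omegaUnipotentPow p m M a y = unipotentPow M (2 * p ^ m) a y := by
  induction a generalizing y with
  | zero => rfl
  | succ a ih =>
    calc omegaUnipotentPow p m M (a + 1) y
        = omegaUnipotentPow p m M a ((1 + omegaSqShiftEnd p m M) y) := by
          rw [omegaUnipotentPow_def, pow_succ, Module.End.mul_apply, ← omegaUnipotentPow_def]
      _ = omegaUnipotentPow p m M a ((1 + shiftEnd M (2 * p ^ m)) y) := by
          rw [LinearMap.add_apply, LinearMap.add_apply, omegaSqShiftEnd_apply_of_torsion y hy]
      _ = unipotentPow M (2 * p ^ m) a ((1 + shiftEnd M (2 * p ^ m)) y) :=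
          ih _ (torsion_one_add_shiftEnd_apply y hy)
      _ = unipotentPow M (2 * p ^ m) (a + 1) y := by
          rw [unipotentPow, unipotentPow, pow_succ, Module.End.mul_apply]

end OmegaOps

/-! ## §4 The `ω²`-carrier `κ.twistModOmegaSq ρ hM m` as a discrete `Γ_K`-module -/

namespace ZpExtension

variable {K : Type u} [Field K] {p : ℕ} [Fact p.Prime] (κ : ZpExtension K p)

variable {M : Type u} [AddCommGroup M] [TopologicalSpace M] [DiscreteTopology M] {k : ℕ}

/-- `m ≤ 2·p^m` (`m < p^m`); private helper for admissible exponent levels. [folklore] -/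
private theorem le_two_mul_prime_pow (m : ℕ) : m ≤ 2 * p ^ m :=
  (Nat.lt_pow_self (Fact.out : p.Prime).one_lt).le.trans (Nat.le_mul_of_pos_left _ Nat.two_pos)

omit [TopologicalSpace M] [DiscreteTopology M] in
/-- For `p^k • M = 0` and an admissible level `N ≥ m + k`, the operator `U_{κ(g) mod p^{N'}}` read at any
higher level `N' ≥ N` equals the one read at level `N`. [cite: Washington1997, §13.1–§13.2] -/
theorem omegaUnipotentPow_twistExponent_of_level_le (hM : ∀ x : M, p ^ k • x = 0) {m N N' : ℕ}
    (hN : m + k ≤ N) (hNN' : N ≤ N') (g : absoluteGaloisGroup K) :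
    omegaUnipotentPow p m M (κ.twistExponent N' g) = omegaUnipotentPow p m M (κ.twistExponent N g) := by
  rw [← κ.twistExponent_mod_pow N' hNN' g, omegaUnipotentPow_mod hM hN]

omit [TopologicalSpace M] [DiscreteTopology M] in
/-- Any two admissible levels (`≥ m + k`) give the same operator `U_{κ(g)}` on the `ω²`-carrier
(`p^k • M = 0`). [cite: Washington1997, §13.1–§13.2] -/
theorem omegaUnipotentPow_twistExponent_eq_of_level (hM : ∀ x : M, p ^ k • x = 0) {m N N' : ℕ}
    (hN : m + k ≤ N) (hN' : m + k ≤ N') (g : absoluteGaloisGroup K) :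
    omegaUnipotentPow p m M (κ.twistExponent N g) = omegaUnipotentPow p m M (κ.twistExponent N' g) := by
  rcases le_total N N' with h | h
  · exact (κ.omegaUnipotentPow_twistExponent_of_level_le hM hN h g).symm
  · exact κ.omegaUnipotentPow_twistExponent_of_level_le hM hN' h g

/-- The **`ω²`-twist as a representation**: `g ∈ Γ_K` acts on `Fin (2·p^m) → M`
(`= M ⊗ (ℤ/p^k)[T]/(ω_{p^m}²)`) by `U_{κ(g)} ∘ ρ(g) = (1+S_ω)^{κ(g)} ∘ ρ(g)`, i.e. by `ρ(g) ⊗ γ^{κ(g)}` — the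
action of `Γ_K` on `M ⊗ Λ/(p^k, ω_{p^m}²)(χ_κ)`, `Λ = ℤ_p⟦T⟧`, `T = γ − 1`, `χ_κ` the tautological character.
The exponent is read modulo `p^{2p^m+k}`; well defined because `U_{p^{m+k}} = 1` (`p^k • M = 0`).
Ref: Mazur–Rubin, Mem. AMS 799 (2004) §5.3 (`T ⊗ Λ/𝔪^kΛ`-type coefficients); Rubin, *Euler Systems* §II.4;
cell bsd-f3-mu MEMO-es §15 (ring `Λ/(p^{n+1}, ω²)`). [cite: MazurRubin2004, §5.3] -/
def twistModOmegaSqRepresentation (ρ : DiscreteGaloisModule K M) (hM : ∀ x : M, p ^ k • x = 0) (m : ℕ) :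
    Representation ℤ (absoluteGaloisGroup K) (Fin (2 * p ^ m) → M) where
  toFun g := omegaUnipotentPow p m M (κ.twistExponent (2 * p ^ m + k) g) * (ρ g).compLeft (Fin (2 * p ^ m))
  map_one' := by
    rw [twistExponent_one, omegaUnipotentPow_zero, one_mul, map_one, compLeft_one]
  map_mul' g h := by
    rw [twistExponent_mul,
      omegaUnipotentPow_mod hM (Nat.add_le_add_right (le_two_mul_prime_pow m) k), omegaUnipotentPow_add,
      map_mul, compLeft_mul, mul_assoc,
      ← mul_assoc (omegaUnipotentPow p m M (κ.twistExponent (2 * p ^ m + k) h)),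
      omegaUnipotentPow_mul_compLeft, mul_assoc, mul_assoc]

/-- Unfolding lemma for `twistModOmegaSqRepresentation`. [cite: MazurRubin2004, §5.3] -/
theorem twistModOmegaSqRepresentation_apply (ρ : DiscreteGaloisModule K M) (hM : ∀ x : M, p ^ k • x = 0)
    (m : ℕ) (g : absoluteGaloisGroup K) (x : Fin (2 * p ^ m) → M) :
    κ.twistModOmegaSqRepresentation ρ hM m g x =
      omegaUnipotentPow p m M (κ.twistExponent (2 * p ^ m + k) g) (fun i => ρ g (x i)) := rfl

/-- **The `ω²`-CARRIER `M ⊗ (ℤ/p^k)[T]/(ω_{p^m}²)(χ_κ)` AS A DISCRETE `Γ_K`-MODULE** (`κ.twistModOmegaSq ρ hM m`,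
`hM : ∀ x, p^k • x = 0`, `ω_{p^m} = (1+T)^{p^m} − 1`), realised on the `T`-basis as `Fin (2·p^m) → M` with `T`
acting by the companion operator `S_ω` of `ω_{p^m}²` and `g ∈ Γ_K` by `(1+S_ω)^{κ(g)} ∘ ρ(g)`: the
representation `twistModOmegaSqRepresentation` is continuous for the discrete topology, the stabiliser of
`x` containing `⋂_i Stab_ρ(x_i) ∩ Gal(K̄/K_{2p^m+k})`.  This is the coefficient module of the graded core
at level `(p^k, ω²)` of MEMO-es §15/§25.3 (T-es-6 (b)): `H¹(K, ·)`, `H1 T U`, localisation and Selmer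
structures of the tree are evaluated on it; its reduction to `p`-torsion coefficients IS the model
`κ.twistModP _ _ (2·p^m)` (`twistModOmegaSq_eq_twistModP`, §5).
Ref: Mazur–Rubin, Mem. AMS 799 (2004) §5.3; Washington §7.1 (`Λ/(p^k, f)` for distinguished `f`).
[cite: MazurRubin2004, §5.3] -/
def twistModOmegaSq (ρ : DiscreteGaloisModule K M) (hM : ∀ x : M, p ^ k • x = 0) (m : ℕ) :
    DiscreteGaloisModule K (Fin (2 * p ^ m) → M) :=
  ContinuousRep.ofStabilizerMemNhdsOne (κ.twistModOmegaSqRepresentation ρ hM m) fun x => by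
    have h1 : (κ.layerSubgroup (2 * p ^ m + k) : Set (absoluteGaloisGroup K)) ∈
        𝓝 (1 : absoluteGaloisGroup K) :=
      (κ.isOpen_layerSubgroup (2 * p ^ m + k)).mem_nhds (one_mem _)
    have h2 : (⋂ i : Fin (2 * p ^ m), {σ : absoluteGaloisGroup K | ρ σ (x i) = x i}) ∈
        𝓝 (1 : absoluteGaloisGroup K) :=
      (Filter.iInter_mem).2 fun i => ρ.setOf_apply_eq_mem_nhds_one (x i)
    filter_upwards [h1, h2] with σ hσ1 hσ2
    simp only [Set.mem_iInter, Set.mem_setOf_eq] at hσ2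
    simp only [twistModOmegaSqRepresentation_apply,
      omegaUnipotentPow_eq_one_of_dvd hM (Nat.add_le_add_right (le_two_mul_prime_pow m) k)
        (κ.prime_pow_dvd_twistExponent le_rfl hσ1),
      Module.End.one_apply]
    funext i
    exact hσ2 i

variable (ρ : DiscreteGaloisModule K M) (hM : ∀ x : M, p ^ k • x = 0) (m : ℕ)

/-- Unfolding lemma: `g` acts on the `ω²`-carrier by `U_{κ(g) mod p^{2p^m+k}}` after `ρ(g)` coordinatewise.
[cite: MazurRubin2004, §5.3] -/
theorem twistModOmegaSq_apply (g : absoluteGaloisGroup K) (x : Fin (2 * p ^ m) → M) :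
    κ.twistModOmegaSq ρ hM m g x =
      omegaUnipotentPow p m M (κ.twistExponent (2 * p ^ m + k) g) (fun i => ρ g (x i)) := rfl

/-- **Level independence**: for ANY admissible level `N ≥ m + k`, `g` acts on the `ω²`-carrier by
`U_{κ(g) mod p^N}` after `ρ(g)` — the twist character `g ↦ (1+T)^{κ(g)} ∈ ((ℤ/p^k)[T]/(ω_{p^m}²))^×` factors
through `Γ/Γ^{p^{m+k}}`. [cite: Washington1997, §13.1–§13.2] -/
theorem twistModOmegaSq_apply_of_level {N : ℕ} (hN : m + k ≤ N) (g : absoluteGaloisGroup K)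
    (x : Fin (2 * p ^ m) → M) :
    κ.twistModOmegaSq ρ hM m g x = omegaUnipotentPow p m M (κ.twistExponent N g) (fun i => ρ g (x i)) := by
  rw [twistModOmegaSq_apply, κ.omegaUnipotentPow_twistExponent_eq_of_level hM
    (Nat.add_le_add_right (le_two_mul_prime_pow m) k) hN]

/-- **`S_ω` (multiplication by `T`) is `Γ_K`-equivariant**: the `ω²`-carrier is a module over
`(ℤ/p^k)[T]/(ω_{p^m}²)` with a `T`-linear Galois action. [cite: Washington1997, §13.1–§13.2] -/
theorem omegaSqShiftEnd_twistModOmegaSq_apply (g : absoluteGaloisGroup K) (x : Fin (2 * p ^ m) → M) :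
    omegaSqShiftEnd p m M (κ.twistModOmegaSq ρ hM m g x) =
      κ.twistModOmegaSq ρ hM m g (omegaSqShiftEnd p m M x) := by
  change (omegaSqShiftEnd p m M * (omegaUnipotentPow p m M (κ.twistExponent (2 * p ^ m + k) g) *
      (ρ g).compLeft (Fin (2 * p ^ m)))) x =
    (omegaUnipotentPow p m M (κ.twistExponent (2 * p ^ m + k) g) * (ρ g).compLeft (Fin (2 * p ^ m)) *
      omegaSqShiftEnd p m M) x
  rw [← mul_assoc, (commute_omegaSqShiftEnd_omegaUnipotentPow _).eq, mul_assoc,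
    omegaSqShiftEnd_mul_compLeft, mul_assoc]

/-- **`Ω` (multiplication by `ω_{p^m}`) is `Γ_K`-equivariant** on the `ω²`-carrier. [cite: Washington1997, §13.1–§13.2] -/
theorem omegaEnd_twistModOmegaSq_apply (g : absoluteGaloisGroup K) (x : Fin (2 * p ^ m) → M) :
    omegaEnd p m M (κ.twistModOmegaSq ρ hM m g x) = κ.twistModOmegaSq ρ hM m g (omegaEnd p m M x) := by
  change (omegaEnd p m M * (omegaUnipotentPow p m M (κ.twistExponent (2 * p ^ m + k) g) *
      (ρ g).compLeft (Fin (2 * p ^ m)))) x =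
    (omegaUnipotentPow p m M (κ.twistExponent (2 * p ^ m + k) g) * (ρ g).compLeft (Fin (2 * p ^ m)) *
      omegaEnd p m M) x
  rw [← mul_assoc, (commute_omegaEnd_omegaUnipotentPow _).eq, mul_assoc, omegaEnd_mul_compLeft, mul_assoc]

/-- **`Gal(K̄/K_N)` acts on the `ω²`-carrier through `ρ` alone when `N ≥ m + k`** (the twist character is
trivial on `κ.layerSubgroup N`: `(1+T)^{p^N} = 1` in `(ℤ/p^k)[T]/(ω_{p^m}²)`). [cite: Washington1997, §13.1–§13.2] -/
theorem twistModOmegaSq_apply_of_mem_layerSubgroup {N : ℕ} (hN : m + k ≤ N) {g : absoluteGaloisGroup K}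
    (hg : g ∈ κ.layerSubgroup N) (x : Fin (2 * p ^ m) → M) :
    κ.twistModOmegaSq ρ hM m g x = fun i => ρ g (x i) := by
  rw [κ.twistModOmegaSq_apply_of_level ρ hM m hN,
    omegaUnipotentPow_eq_one_of_dvd hM hN (κ.prime_pow_dvd_twistExponent le_rfl hg), Module.End.one_apply]

/-- **`Gal(K̄/K_m) = Γ^{p^m}` acts on the `ω²`-carrier through `1 + ℤ·Ω`**: for `g ∈ κ.layerSubgroup m`,
`κ(g) = p^m c` and `g` acts by `(1 + Ω)^c ∘ ρ(g) = (1 + c·Ω) ∘ ρ(g)` with `c = (κ(g) mod p^{2p^m+k}) / p^m`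
(`γ^{p^m c} = (1 + ω_{p^m})^c`, `ω_{p^m}² = 0`). [cite: Washington1997, §7.1–§7.2] -/
theorem twistModOmegaSq_apply_of_mem_layerSubgroup_self {g : absoluteGaloisGroup K}
    (hg : g ∈ κ.layerSubgroup m) (x : Fin (2 * p ^ m) → M) :
    κ.twistModOmegaSq ρ hM m g x =
      (1 + ((κ.twistExponent (2 * p ^ m + k) g / p ^ m : ℕ) : Module.End ℤ (Fin (2 * p ^ m) → M)) *
        omegaEnd p m M) (fun i => ρ g (x i)) := by
  obtain ⟨c, hc⟩ := κ.prime_pow_dvd_twistExponent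
    ((le_two_mul_prime_pow (p := p) m).trans (Nat.le_add_right _ k)) hg
  have hp : 0 < p ^ m := pow_pos (Fact.out : p.Prime).pos m
  rw [twistModOmegaSq_apply, hc, Nat.mul_div_cancel_left c hp, omegaUnipotentPow_def, pow_mul,
    ← omegaUnipotentPow_def, omegaUnipotentPow_prime_pow, one_add_omegaEnd_pow]

/-- **A topological generator `γ` (`κ γ = 1`) acts on the `ω²`-carrier by `(1 + S_ω) ∘ ρ(γ)`**:
`T = γ − 1` IS `S_ω` on `ρ(γ)`-fixed coordinates. [cite: Washington1997, §13.1–§13.2] -/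
theorem twistModOmegaSq_apply_of_isTopGenerator {γ : absoluteGaloisGroup K} (hγ : κ.IsTopGenerator γ)
    (x : Fin (2 * p ^ m) → M) :
    κ.twistModOmegaSq ρ hM m γ x = (1 + omegaSqShiftEnd p m M) (fun i => ρ γ (x i)) := by
  haveI : Fact (1 < p ^ (2 * p ^ m + k)) :=
    ⟨Nat.one_lt_pow (by have := pow_pos (Fact.out : p.Prime).pos m; omega) (Fact.out : p.Prime).one_lt⟩
  have hexp : κ.twistExponent (2 * p ^ m + k) γ = 1 := by
    rw [twistExponent, show κ γ = Multiplicative.ofAdd 1 from hγ, toAdd_ofAdd, map_one, ZMod.val_one]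
  rw [twistModOmegaSq_apply, hexp, omegaUnipotentPow_one]

/-- On the `ω²`-carrier, `γ − 1` acts as `S_ω` composed with `ρ(γ)`: `γ•x − ρ(γ)x = S_ω(ρ(γ) x)`.
[cite: Washington1997, §13.1–§13.2] -/
theorem twistModOmegaSq_apply_sub_of_isTopGenerator {γ : absoluteGaloisGroup K} (hγ : κ.IsTopGenerator γ)
    (x : Fin (2 * p ^ m) → M) :
    κ.twistModOmegaSq ρ hM m γ x - (fun i => ρ γ (x i)) = omegaSqShiftEnd p m M (fun i => ρ γ (x i)) := by
  rw [twistModOmegaSq_apply_of_isTopGenerator κ ρ hM m hγ, LinearMap.add_apply, Module.End.one_apply,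
    add_sub_cancel_left]

/-! ### The equivariant endomorphisms `T·` and `ω·` of the carrier -/

/-- **`T· : carrier → carrier`** (`S_ω`) as a continuous `Γ_K`-equivariant endomorphism of the `ω²`-carrier
(usable in `galoisCohomology.map`). [cite: Washington1997, §13.1–§13.2] -/
def twistModOmegaSqShift :
    (κ.twistModOmegaSq ρ hM m).toContRepresentation →ⁱL (κ.twistModOmegaSq ρ hM m).toContRepresentation where
  toContinuousLinearMap :=
    { toFun := omegaSqShiftEnd p m M
      map_add' := map_add _
      map_smul' := fun c x => LinearMap.map_smul _ c x
      cont := continuous_of_discreteTopology }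
  isIntertwining' g := by
    refine ContinuousLinearMap.ext fun x => ?_
    exact κ.omegaSqShiftEnd_twistModOmegaSq_apply ρ hM m g x

/-- Unfolding lemma for `twistModOmegaSqShift`. [cite: Washington1997, §13.1–§13.2] -/
@[simp] theorem twistModOmegaSqShift_apply (x : Fin (2 * p ^ m) → M) :
    κ.twistModOmegaSqShift ρ hM m x = omegaSqShiftEnd p m M x := rfl

/-- **`ω· : carrier → carrier`** (`Ω`) as a continuous `Γ_K`-equivariant endomorphism of the `ω²`-carrier —
the first map of `0 → ω·carrier → carrier → carrier/ω → 0` (item (ii) of the ask; `ω·ω· = 0` is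
`twistModOmegaSqOmega_apply_apply`; the ring fact `ann(ω) = (ω)` in `R[T]/(ω²)` is the tree's Summits-side
`GradedRing.annihilator_of_monic_sq`). [cite: Washington1997, §7.1–§7.2] -/
def twistModOmegaSqOmega :
    (κ.twistModOmegaSq ρ hM m).toContRepresentation →ⁱL (κ.twistModOmegaSq ρ hM m).toContRepresentation where
  toContinuousLinearMap :=
    { toFun := omegaEnd p m M
      map_add' := map_add _
      map_smul' := fun c x => LinearMap.map_smul _ c x
      cont := continuous_of_discreteTopology }
  isIntertwining' g := by
    refine ContinuousLinearMap.ext fun x => ?_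
    exact κ.omegaEnd_twistModOmegaSq_apply ρ hM m g x

/-- Unfolding lemma for `twistModOmegaSqOmega`. [cite: Washington1997, §7.1–§7.2] -/
@[simp] theorem twistModOmegaSqOmega_apply (x : Fin (2 * p ^ m) → M) :
    κ.twistModOmegaSqOmega ρ hM m x = omegaEnd p m M x := rfl

/-- **`ω·ω· = 0` on the carrier** (`ω·carrier ⊆ ker ω·`). [cite: Washington1997, §7.1–§7.2] -/
theorem twistModOmegaSqOmega_apply_apply (x : Fin (2 * p ^ m) → M) :
    κ.twistModOmegaSqOmega ρ hM m (κ.twistModOmegaSqOmega ρ hM m x) = 0 :=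
  omegaEnd_omegaEnd_apply x

/-- `ω· = γ^{p^m} − 1` on the carrier: `Ω x = U_{p^m} x − x`. [cite: Washington1997, §7.1–§7.2] -/
theorem twistModOmegaSqOmega_apply_eq (x : Fin (2 * p ^ m) → M) :
    κ.twistModOmegaSqOmega ρ hM m x = omegaUnipotentPow p m M (p ^ m) x - x := by
  rw [twistModOmegaSqOmega_apply, omegaEnd_eq, LinearMap.sub_apply, Module.End.one_apply]

/-! ### Functoriality in the coefficient module -/

section Map

variable {M'' : Type u} [AddCommGroup M''] [TopologicalSpace M''] [DiscreteTopology M''] {k'' : ℕ}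
  (ρ'' : DiscreteGaloisModule K M'') (hM'' : ∀ x : M'', p ^ k'' • x = 0)

/-- **Functoriality of the `ω²`-carrier in the coefficient module**: a continuous `Γ_K`-equivariant map
`g : M → M''` (`M` killed by `p^k`, `M''` by `p^{k''}`) induces the equivariant map `x ↦ g ∘ x` of
`ω²`-carriers (both actions read at the common admissible level `2p^m + k + k''`; e.g. `p• : E[p^k] → E[p^{k−1}]`).
A continuous intertwining map, usable in `galoisCohomology.map`. [cite: MazurRubin2004, §5.3] -/
def twistModOmegaSqMap (g : ρ.toContRepresentation →ⁱL ρ''.toContRepresentation) :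
    (κ.twistModOmegaSq ρ hM m).toContRepresentation →ⁱL (κ.twistModOmegaSq ρ'' hM'' m).toContRepresentation where
  toContinuousLinearMap :=
    { toFun := fun x i => g (x i)
      map_add' := fun x y => funext fun i => map_add g (x i) (y i)
      map_smul' := fun c x => funext fun i => by
        simp only [Pi.smul_apply, RingHom.id_apply, map_zsmul]
      cont := continuous_of_discreteTopology }
  isIntertwining' σ := by
    refine ContinuousLinearMap.ext fun x => ?_
    change (fun i => g (κ.twistModOmegaSq ρ hM m σ x i)) = κ.twistModOmegaSq ρ'' hM'' m σ (fun i => g (x i))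
    have hm := le_two_mul_prime_pow (p := p) m
    rw [κ.twistModOmegaSq_apply_of_level ρ hM m (N := 2 * p ^ m + k + k'') (by omega) σ,
      κ.twistModOmegaSq_apply_of_level ρ'' hM'' m (N := 2 * p ^ m + k + k'') (by omega) σ,
      map_omegaUnipotentPow_apply g]
    congr 1
    funext i
    exact g.isIntertwining σ (x i)

/-- Unfolding lemma for `twistModOmegaSqMap`: `(g_* x)_i = g (x_i)`. [cite: MazurRubin2004, §5.3] -/
@[simp] theorem twistModOmegaSqMap_apply (g : ρ.toContRepresentation →ⁱL ρ''.toContRepresentation)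
    (x : Fin (2 * p ^ m) → M) :
    κ.twistModOmegaSqMap ρ hM m ρ'' hM'' g x = fun i => g (x i) := rfl

end Map

/-! ## §5 Reduction modulo `p`: the `ω²`-carrier on `p`-torsion coefficients IS `𝒯_{2p^m}`, the map `ι`,
and injectivity of `ι_*` on `H¹` -/

/-- On a module killed by `p`, the `ω²`-carrier and the model `𝒯_{2p^m}` (`κ.twistModP`) act identically:
`S_ω ≡ S (mod p)` and the exponents agree modulo `p^{2p^m}`. [cite: Washington1997, §7.1–§7.2] -/
theorem twistModOmegaSq_apply_eq_twistModP_apply (hM1 : ∀ x : M, p • x = 0) (g : absoluteGaloisGroup K)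
    (x : Fin (2 * p ^ m) → M) :
    κ.twistModOmegaSq ρ hM m g x = κ.twistModP ρ hM1 (2 * p ^ m) g x := by
  rw [twistModOmegaSq_apply, twistModP_apply, omegaUnipotentPow_apply_of_torsion _ _ fun i => hM1 _,
    κ.unipotentPow_twistExponent_of_le (2 * p ^ m + k) hM1 (Nat.le_add_right _ k) g]

/-- **REDUCTION MOD `p` (item (i))**: on `p`-torsion coefficients the `ω²`-carrier IS the model
`κ.twistModP ρ hM1 (2·p^m) = M ⊗ 𝔽_p[T]/(T^{2p^m})(χ_κ)` — `ω_{p^m}² ≡ T^{2p^m} (mod p)` — as discrete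
Galois modules (equality, hence an explicit isomorphism `ι = id` on the carrier `Fin (2·p^m) → M`).
[cite: Washington1997, §7.1–§7.2] -/
theorem twistModOmegaSq_eq_twistModP (hM1 : ∀ x : M, p • x = 0) :
    κ.twistModOmegaSq ρ hM m = κ.twistModP ρ hM1 (2 * p ^ m) :=
  ContinuousRep.ext fun g => LinearMap.ext fun x => κ.twistModOmegaSq_apply_eq_twistModP_apply ρ hM m hM1 g x

section ModP

variable {M' : Type u} [AddCommGroup M'] [TopologicalSpace M'] [DiscreteTopology M']
  (ρ' : DiscreteGaloisModule K M') (hM1 : ∀ x : M', p • x = 0)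

/-- **The map `ι : 𝒯_{2p^m}(M') → (ω²-carrier of M)`** along a continuous `Γ_K`-equivariant `f : M' → M` out of
a module killed by `p` (e.g. the inclusion `E[p] = E[p^k][p] ⊂ E[p^k]`, identifying `𝒯_{2p^m}(E[p])` with the
`p`-torsion of the `ω²`-carrier of `E[p^k]`): `x ↦ f ∘ x`, OUT OF THE MODEL `κ.twistModP ρ' hM1 (2·p^m)`;
equivariant because the image coordinates are `p`-torsion, on which `S_ω = S` and the exponent levels agree.
`ι_* := galoisCohomology.map ι 1 : H¹(K, 𝒯_{2p^m}(M')) → H¹(K, ω²-carrier)`. [cite: MazurRubin2004, §5.3] -/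
def twistModPToOmegaSq (f : ρ'.toContRepresentation →ⁱL ρ.toContRepresentation) :
    (κ.twistModP ρ' hM1 (2 * p ^ m)).toContRepresentation →ⁱL
      (κ.twistModOmegaSq ρ hM m).toContRepresentation where
  toContinuousLinearMap :=
    { toFun := fun x i => f (x i)
      map_add' := fun x y => funext fun i => map_add f (x i) (y i)
      map_smul' := fun c x => funext fun i => by
        simp only [Pi.smul_apply, RingHom.id_apply, map_zsmul]
      cont := continuous_of_discreteTopology }
  isIntertwining' g := by
    refine ContinuousLinearMap.ext fun x => ?_
    change (fun i => f (κ.twistModP ρ' hM1 (2 * p ^ m) g x i)) =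
      κ.twistModOmegaSq ρ hM m g (fun i => f (x i))
    have htor : ∀ i, p • ρ g (f (x i)) = 0 := fun i => by
      rw [← map_nsmul, ← map_nsmul, hM1, map_zero, map_zero]
    rw [twistModP_apply, twistModOmegaSq_apply,
      ← κ.unipotentPow_twistExponent_of_le (2 * p ^ m + k) hM1 (Nat.le_add_right _ k) g,
      map_unipotentPow_apply f, omegaUnipotentPow_apply_of_torsion _ _ htor]
    congr 1
    funext i
    exact f.isIntertwining g (x i)

/-- Unfolding lemma for `twistModPToOmegaSq`: `(ι x)_i = f (x_i)`. [cite: MazurRubin2004, §5.3] -/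
@[simp] theorem twistModPToOmegaSq_apply (f : ρ'.toContRepresentation →ⁱL ρ.toContRepresentation)
    (x : Fin (2 * p ^ m) → M') :
    κ.twistModPToOmegaSq ρ hM m ρ' hM1 f x = fun i => f (x i) := rfl

variable {M'' : Type u} [AddCommGroup M''] [TopologicalSpace M''] [DiscreteTopology M''] {k'' : ℕ}
  (ρ'' : DiscreteGaloisModule K M'') (hM'' : ∀ x : M'', p ^ k'' • x = 0)

/-- **A short exact sequence of coefficient modules `0 → M' →f M →g M'' → 0` (`M'` killed by `p`) gives the
short exact sequence of carriers `0 → 𝒯_{2p^m}(M') →ι (ω²-carrier of M) →g_* (ω²-carrier of M'') → 0`**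
(coordinatewise; e.g. `0 → E[p] → E[p^k] →(p•) E[p^{k−1}] → 0`).  Tree `IsSES`, so the long exact
cohomology sequence (`IsSES.δ₀`, `exists_δ₀_eq_of_map_one_eq_zero`, …) applies. [cite: SerreGaloisCohomology1997, I §2.2] -/
theorem isSES_twistModPToOmegaSq (f : ρ'.toContRepresentation →ⁱL ρ.toContRepresentation)
    (g : ρ.toContRepresentation →ⁱL ρ''.toContRepresentation)
    (h : IsSES (TopRep.ofHom ⟨f.toContinuousLinearMap, f.isIntertwining'⟩ : ρ'.toTopRep ⟶ ρ.toTopRep)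
      (TopRep.ofHom ⟨g.toContinuousLinearMap, g.isIntertwining'⟩ : ρ.toTopRep ⟶ ρ''.toTopRep)) :
    IsSES
      (TopRep.ofHom ⟨(κ.twistModPToOmegaSq ρ hM m ρ' hM1 f).toContinuousLinearMap,
          (κ.twistModPToOmegaSq ρ hM m ρ' hM1 f).isIntertwining'⟩ :
        (κ.twistModP ρ' hM1 (2 * p ^ m)).toTopRep ⟶ (κ.twistModOmegaSq ρ hM m).toTopRep)
      (TopRep.ofHom ⟨(κ.twistModOmegaSqMap ρ hM m ρ'' hM'' g).toContinuousLinearMap,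
          (κ.twistModOmegaSqMap ρ hM m ρ'' hM'' g).isIntertwining'⟩ :
        (κ.twistModOmegaSq ρ hM m).toTopRep ⟶ (κ.twistModOmegaSq ρ'' hM'' m).toTopRep) where
  comp_eq_zero := by
    refine TopRep.hom_ext (ContIntertwiningMap.ext (ContinuousLinearMap.ext fun x => ?_))
    change (fun i => g (f (x i))) = (0 : Fin (2 * p ^ m) → M'')
    funext i
    exact h.g_f_apply (x i)
  injective := by
    intro x y hxy
    change (fun i => f (x i)) = (fun i => f (y i)) at hxy
    funext i
    exact h.injective (congrFun hxy i)
  exact_mid := by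
    intro y hy
    change (fun i => g (y i)) = (0 : Fin (2 * p ^ m) → M'') at hy
    choose x hx using fun i => h.exact_mid (y i) (congrFun hy i)
    exact ⟨x, funext hx⟩
  surjective := by
    intro z
    choose x hx using fun i => h.surjective (z i)
    exact ⟨x, funext hx⟩

/-- **Left exactness of `H⁰` along the carriers (dévissage step)**: if the invariants of the model
`𝒯_{2p^m}(M')` and of the `ω²`-carrier of `M''` vanish, so do those of the `ω²`-carrier of `M`
(`0 → M' → M → M'' → 0` exact; iterate over `0 → E[p] → E[p^j] → E[p^{j−1}] → 0` to reduce the vanishing of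
`H⁰` of every `ω²`-carrier of `E[p^j]` to that of the mod-`p` model). [cite: SerreGaloisCohomology1997, I §2.2] -/
theorem twistModOmegaSq_invariant_eq_zero_of_isSES (f : ρ'.toContRepresentation →ⁱL ρ.toContRepresentation)
    (g : ρ.toContRepresentation →ⁱL ρ''.toContRepresentation)
    (h : IsSES (TopRep.ofHom ⟨f.toContinuousLinearMap, f.isIntertwining'⟩ : ρ'.toTopRep ⟶ ρ.toTopRep)
      (TopRep.ofHom ⟨g.toContinuousLinearMap, g.isIntertwining'⟩ : ρ.toTopRep ⟶ ρ''.toTopRep))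
    (h' : ∀ u : Fin (2 * p ^ m) → M',
      (∀ σ : absoluteGaloisGroup K, κ.twistModP ρ' hM1 (2 * p ^ m) σ u = u) → u = 0)
    (h'' : ∀ v : Fin (2 * p ^ m) → M'',
      (∀ σ : absoluteGaloisGroup K, κ.twistModOmegaSq ρ'' hM'' m σ v = v) → v = 0)
    (w : Fin (2 * p ^ m) → M) (hw : ∀ σ : absoluteGaloisGroup K, κ.twistModOmegaSq ρ hM m σ w = w) :
    w = 0 := by
  have hS := κ.isSES_twistModPToOmegaSq ρ hM m ρ' hM1 ρ'' hM'' f g h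
  have hgw : (fun i => g (w i)) = 0 := h'' _ fun σ => by
    have key : (fun i => g (κ.twistModOmegaSq ρ hM m σ w i)) =
        κ.twistModOmegaSq ρ'' hM'' m σ (fun i => g (w i)) :=
      ContinuousRep.hom_comm_apply (TopRep.ofHom ⟨(κ.twistModOmegaSqMap ρ hM m ρ'' hM'' g).toContinuousLinearMap,
          (κ.twistModOmegaSqMap ρ hM m ρ'' hM'' g).isIntertwining'⟩ :
        (κ.twistModOmegaSq ρ hM m).toTopRep ⟶ (κ.twistModOmegaSq ρ'' hM'' m).toTopRep) σ w
    rw [hw σ] at key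
    exact key.symm
  obtain ⟨u, hu⟩ := hS.exact_mid w hgw
  change (fun i => f (u i)) = w at hu
  have huinv : ∀ σ : absoluteGaloisGroup K, κ.twistModP ρ' hM1 (2 * p ^ m) σ u = u := fun σ => by
    refine hS.injective ?_
    change (fun i => f (κ.twistModP ρ' hM1 (2 * p ^ m) σ u i)) = fun i => f (u i)
    have key : (fun i => f (κ.twistModP ρ' hM1 (2 * p ^ m) σ u i)) =
        κ.twistModOmegaSq ρ hM m σ (fun i => f (u i)) :=
      ContinuousRep.hom_comm_apply (TopRep.ofHom ⟨(κ.twistModPToOmegaSq ρ hM m ρ' hM1 f).toContinuousLinearMap,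
          (κ.twistModPToOmegaSq ρ hM m ρ' hM1 f).isIntertwining'⟩ :
        (κ.twistModP ρ' hM1 (2 * p ^ m)).toTopRep ⟶ (κ.twistModOmegaSq ρ hM m).toTopRep) σ u
    rw [key, hu, hw σ]
  rw [← hu, h' u huinv]
  funext i
  exact map_zero f

/-- **`ι_* : H¹(K, 𝒯_{2p^m}(M')) → H¹(K, ω²-carrier of M)` IS INJECTIVE as soon as the invariants of the
`ω²`-carrier of the cokernel module `M''` vanish** (`0 → M' → M → M'' → 0` exact): its kernel is
`δ₀(H⁰(K, ω²-carrier of M'')) = 0` (tree `IsSES.exists_δ₀_eq_of_map_one_eq_zero`).  With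
`twistModOmegaSq_invariant_eq_zero_of_isSES` the vanishing hypothesis reduces to `H⁰` of the mod-`p` model
(item (i) of the ask: "`ι_*` injective when `H⁰` of the mod-`p` model vanishes").
[cite: SerreGaloisCohomology1997, I §2.2] -/
theorem map_twistModPToOmegaSq_injective_of_isSES (f : ρ'.toContRepresentation →ⁱL ρ.toContRepresentation)
    (g : ρ.toContRepresentation →ⁱL ρ''.toContRepresentation)
    (h : IsSES (TopRep.ofHom ⟨f.toContinuousLinearMap, f.isIntertwining'⟩ : ρ'.toTopRep ⟶ ρ.toTopRep)
      (TopRep.ofHom ⟨g.toContinuousLinearMap, g.isIntertwining'⟩ : ρ.toTopRep ⟶ ρ''.toTopRep))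
    (hinv : ∀ v : Fin (2 * p ^ m) → M'',
      (∀ σ : absoluteGaloisGroup K, κ.twistModOmegaSq ρ'' hM'' m σ v = v) → v = 0) :
    Function.Injective (galoisCohomology.map (κ.twistModPToOmegaSq ρ hM m ρ' hM1 f) 1) := by
  refine (injective_iff_map_eq_zero _).mpr fun w hw => ?_
  obtain ⟨v, hv⟩ :=
    (κ.isSES_twistModPToOmegaSq ρ hM m ρ' hM1 ρ'' hM'' f g h).exists_δ₀_eq_of_map_one_eq_zero w hw
  have hv0 : v = 0 := Subtype.ext (hinv v.1 fun σ => v.2 σ)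
  rw [← hv, hv0, map_zero]
  rfl

end ModP

end ZpExtension

end Literature.NumberTheory.EllipticCurves

/-! ## §6 The elliptic specialisation: the `ω²`-carrier of `E[p^k]` -/

namespace WeierstrassCurve

open Literature.NumberTheory.EllipticCurves Literature.NumberTheory.GaloisRepresentations

variable {F : Type u} [Field F] (W : WeierstrassCurve F) (p : ℕ) [Fact p.Prime] (k : ℕ)
  (κ : ZpExtension F p) (m : ℕ)

/-- **`E[p^k] ⊗ (ℤ/p^k)[T]/(ω_{p^m}²)(χ_κ)`** for a Weierstrass curve `W` over a field `F`, a prime `p`, a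
level `k`, a `ℤ_p`-extension `κ` of `F` and `m`: the `ω²`-carrier (`ZpExtension.twistModOmegaSq`) of the
discrete Galois module `E[p^k] = W.torsionGaloisModule ((p : ℤ) ^ k)` (killed by `p^k`,
`pow_nsmul_geomTorsion_eq_zero`), on `Fin (2·p^m) → E[p^k]`.  For `F = ℚ`, `κ` cyclotomic and `k = n + 1`
this is the coefficient module `T/(p^{n+1}, ω_m²)` of the graded core of MEMO-es §15/§25.3.
[cite: MazurRubin2004, §5.3] -/
def modOmegaSqTwist : DiscreteGaloisModule F (Fin (2 * p ^ m) → geomTorsion W ((p : ℤ) ^ k)) :=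
  κ.twistModOmegaSq (W.torsionGaloisModule ((p : ℤ) ^ k)) (W.pow_nsmul_geomTorsion_eq_zero p k) m

/-- Unfolding lemma: on the `ω²`-carrier of `E[p^k]`, `σ ∈ Γ_F` acts by `U_{κ(σ) mod p^{2p^m+k}}` after `σ`
coordinatewise. [cite: MazurRubin2004, §5.3] -/
theorem modOmegaSqTwist_apply (σ : absoluteGaloisGroup F) (x : Fin (2 * p ^ m) → geomTorsion W ((p : ℤ) ^ k)) :
    W.modOmegaSqTwist p k κ m σ x =
      omegaUnipotentPow p m (geomTorsion W ((p : ℤ) ^ k)) (κ.twistExponent (2 * p ^ m + k) σ)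
        (fun i => σ • x i) :=
  rfl

/-- On the `ω²`-carrier of `E[p^k]`, a topological generator `γ` of `κ` acts by `(1 + S_ω) ∘ γ`: `T = γ − 1`.
[cite: Washington1997, §13.1–§13.2] -/
theorem modOmegaSqTwist_apply_of_isTopGenerator {γ : absoluteGaloisGroup F} (hγ : κ.IsTopGenerator γ)
    (x : Fin (2 * p ^ m) → geomTorsion W ((p : ℤ) ^ k)) :
    W.modOmegaSqTwist p k κ m γ x =
      (1 + omegaSqShiftEnd p m (geomTorsion W ((p : ℤ) ^ k))) (fun i => γ • x i) :=
  ZpExtension.twistModOmegaSq_apply_of_isTopGenerator κ _ _ m hγ x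

/-- On the `ω²`-carrier of `E[p^k]`, `Gal(F̄/F_N)` (`κ.layerSubgroup N`) acts through `E[p^k]` alone when
`N ≥ m + k`. [cite: Washington1997, §13.1–§13.2] -/
theorem modOmegaSqTwist_apply_of_mem_layerSubgroup {N : ℕ} (hN : m + k ≤ N) {σ : absoluteGaloisGroup F}
    (hσ : σ ∈ κ.layerSubgroup N) (x : Fin (2 * p ^ m) → geomTorsion W ((p : ℤ) ^ k)) :
    W.modOmegaSqTwist p k κ m σ x = fun i => σ • x i :=
  ZpExtension.twistModOmegaSq_apply_of_mem_layerSubgroup κ _ _ m hN hσ x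

end WeierstrassCurve

end
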